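import Summits.AtomisticToContinuum.Crystallization.Theorems.ChartedZeroExcessLayeredLatticeLiouvilleZZZYRJ

/-!
# ZZZYRK — the parameter window `Q` of record for line (D) under (γ-E): the HEIGHT BAND read by the letter cells, (EBAND) as an instance of (EE),
# re-banding, the band cover, and the LETTER-BOX E-DOOR (decomp-a2c lens-2, gen 104; companion of ZZZYRJ; census SURV61 / EBAND61 / CERTSIZE61)

ZZZYRJ leaves the window `Q` of the energy enclosure (EE) `EnergyEnclosureP s Λ c₀ ℓ₀ t Q W` a parameter.  The cells of record (ZZZYRCZX hollow
letter cells `InBoxWH s aLo aHi τ hLo hHi`) read three dials of a registered word: scale `a`, slip `τ`, height band `[hLo·a, hHi·a]`.  The scale is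
windowed by `W ⊆ [amin, amax]`, the slip by `HollowP … δ` (energy-blind leaf of record); the ONE dial the energy localises beyond the leaves of
record is the HEIGHT: (EBAND) = (EE) with `Q := InHBand hLoE hHiE` («every admissible word at `a ∈ W` with all site energies `≤ t` has ALL step
heights in `[hLoE·a, hHiE·a]`»; census EBAND61 at ν = 1/2000: h ∈ [0.8059, 0.8270]·a, Δh = 0.021, against the clean band Δh = 0.104 of `HBandP`).
§1 `InHBand`, `HBandP.enclosure` ((EBAND) is WEAKER than the H-band leaf of record at the same band: energy-blind ⇒ every threshold), monotonicity.
§2 `IsRegisteredWordBH.reband` (PROVED): a banded-hollow registered word whose step heights obey a pointwise band is registered in that band.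
§3 `atlasCoversPC_bandWindow` (PROVED): cells covering `[amin, amax] × [hLoE, hHiE]` (slip dial `≥ δ`) cover the class
   `(IsRegisteredWordBH δ hLoB hHiB ∧ a ∈ W) ∧ a ∈ W ∧ InHBand hLoE hHiE` — ARITHMETIC on literals (census SURV61: the TWO cells (0.9718, 1.0, 0 | .035)).
§4 ★★ `uniformTameStabilityAtEIn_of_atlasW_hollow_windowE` (PROVED) = ZZZYRJ glue ∘ `wordStabilityP_of_atlas` ∘ §3: ZZZYREC's `…_window` door with
   the cells covering only the E-letter-box, the new leaf (EBAND)(eStar + ν) — certifiable as (EBAND)(eUp + ν) by `EnergyEnclosureP.of_ceiling` — and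
   the TAME energy-windowed conclusion; (RI♯-C-W), `HBandP`, `HollowP`, per-cell certificates, budget leaves VERBATIM.
0 sorry · no instance / notation / macro / set_option · import = ZZZYRJ (lands after it). [g104]
-/

noncomputable section

namespace Summit.AtomisticToContinuum.Crystallization.Theorems.ChartedZeroExcessLayeredLatticeLiouville

open scoped BigOperators RealInnerProductSpace
open Summit.AtomisticToContinuum.Crystallization.Theorems.ChartedPlanarOrderRigidityDoor (E3 eStar siteEnergy)
open Summit.AtomisticToContinuum.Crystallization.Theorems.ChartedPlanarOrderDensityDichotomy (μS)
open Summit.AtomisticToContinuum.Crystallization.Theorems.ChartedPlanarOrderMesoCut (LayeredHom)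
open Summit.AtomisticToContinuum.Crystallization.Theorems.ChartedPlanarOrderDoorLayered (Layered)
open Literature.MathematicalPhysics.StatisticalMechanics (triangularVec₁ triangularVec₂ PeriodicConfiguration lennardJones)

variable {ι : Type*}

/-! ### §1 the height-band window and (EBAND) -/

/-- ★ **«InHBand hLo hHi»** — the HEIGHT-BAND WINDOW: at scale `a`, every step of the word has normal component (along any unit normal of the chart
plane) of absolute value in `[hLo·a, hHi·a]` (the pointwise body of `HBandP`, ZZZYRCZX).  (EBAND)(t) := `EnergyEnclosureP s Λ c₀ ℓ₀ t (InHBand hLoE hHiE) W`: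
EOS-type · UNDECIDED · INSTRUMENTABLE (census EBAND61) · mechanism (TP (N♮) n1–n3 on homogeneous words): Nash balance fixes ONE transmitted normal
stress per word (`wordStressBalancePIn_holds`, ZZZYRG), the interlayer equation of state is monotone on the clean range, and the homogeneous energy gap
`≥ c·P²` bounds that stress by `O(√ν)`.  Why it might fail: a second clean branch of the interlayer stress equation inside `W`. [g104] -/
def InHBand (hLo hHi : ℝ) : ℝ → (E3 ≃L[ℝ] E3) → (ℤ → E3) → Prop := fun a L w' =>
  ∀ n : E3, ‖n‖ = 1 → ⟪gen₁ L, n⟫ = 0 → ⟪gen₂ L, n⟫ = 0 →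
    ∀ m : ℤ, hLo * a ≤ |⟪w' (m + 1) - w' m, n⟫| ∧ |⟪w' (m + 1) - w' m, n⟫| ≤ hHi * a

/-- a wider band is a weaker window (at `a ≥ 0`). [g104] -/
theorem InHBand.mono {hLo hHi hLo' hHi' a : ℝ} {L : E3 ≃L[ℝ] E3} {w' : ℤ → E3} (hlo : hLo' ≤ hLo) (hhi : hHi ≤ hHi') (ha : 0 ≤ a)
    (h : InHBand hLo hHi a L w') : InHBand hLo' hHi' a L w' := fun n hn hg₁ hg₂ m =>
  ⟨(mul_le_mul_of_nonneg_right hlo ha).trans (h n hn hg₁ hg₂ m).1, (h n hn hg₁ hg₂ m).2.trans (mul_le_mul_of_nonneg_right hhi ha)⟩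

/-- COMPARISON (PROVED): the energy-blind H-band leaf of record gives (EBAND) with the same band at EVERY threshold and window. [g104] -/
theorem HBandP.enclosure {s Λ c₀ ℓ₀ hLoB hHiB : ℝ} (h : HBandP s Λ c₀ ℓ₀ hLoB hHiB) (t : ℝ) (W : Set ℝ) :
    EnergyEnclosureP s Λ c₀ ℓ₀ t (InHBand hLoB hHiB) W := fun a _ ha L w' hA _ n hn hg₁ hg₂ m => h a ha L w' hA n hn hg₁ hg₂ m

/-! ### §2 re-banding a registered word -/

/-- RE-BANDING (PROVED): a banded-hollow registered word (band floor `≥ 0`) lying in the height-band window `[hLo'·a, hHi'·a]` is banded-hollow registered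
in that band (the registered normal component of step `m` IS the height `h m ≥ 0`, `inner_registeredStep`). [g104] -/
theorem IsRegisteredWordBH.reband {δ hLoB hHiB hLo' hHi' a : ℝ} {L : E3 ≃L[ℝ] E3} {w' : ℤ → E3} (hlo : 0 ≤ hLoB) (ha : 0 ≤ a)
    (hreg : IsRegisteredWordBH δ hLoB hHiB a L w') (hband : InHBand hLo' hHi' a L w') : IsRegisteredWordBH δ hLo' hHi' a L w' := by
  obtain ⟨ℓ, n, r, h, hℓ, hH, hn, hg₁, hg₂, hrh, hstep⟩ := hreg
  have hm : ∀ m : ℤ, ⟪w' (m + 1) - w' m, n⟫ = h m := fun m => by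
    rw [hstep m]; exact inner_registeredStep hn hg₁ hg₂ (hrh m).2.1 _ _
  refine ⟨ℓ, n, r, h, hℓ, hH, hn, hg₁, hg₂, fun m => ⟨(hrh m).1, (hrh m).2.1, ?_⟩, hstep⟩
  have hb := hband n hn hg₁ hg₂ m
  rw [hm m, abs_of_nonneg ((mul_nonneg hlo ha).trans (hrh m).2.2.1)] at hb
  exact hb

/-! ### §3 the band cover: cells over `[amin, amax] × [hLoE, hHiE]` -/

/-- JSBOX-SOUND on the E-letter-box (PROVED): cells whose scale windows cover `[amin, amax]`, whose slip dial is `≥ δ` and whose height box CONTAINS the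
E-band `[hLoE, hHiE]` cover every banded-hollow registered admissible word with `a ∈ W ⊆ [amin, amax]` lying in the height-band window. [g104] -/
theorem atlasCoversPC_bandWindow {s Λ c₀ ℓ₀ δ hLoB hHiB hLoE hHiE amin amax : ℝ} {W : Set ℝ} {aLo aHi τ hLo hHi : ι → ℝ} (hlo : 0 ≤ hLoB)
    (hW : W ⊆ Set.Icc amin amax)
    (hcover : ∀ a : ℝ, amin ≤ a → a ≤ amax → ∃ i, aLo i ≤ a ∧ a ≤ aHi i ∧ δ ≤ τ i ∧ hLo i ≤ hLoE ∧ hHiE ≤ hHi i) :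
    AtlasCoversPC s Λ c₀ ℓ₀ (fun a L w' => (IsRegisteredWordBH δ hLoB hHiB a L w' ∧ a ∈ W) ∧ a ∈ W ∧ InHBand hLoE hHiE a L w')
      fun i => InBoxWH s (aLo i) (aHi i) (τ i) (hLo i) (hHi i) := by
  intro a ha L w' hA hc
  obtain ⟨⟨hreg, haW⟩, -, hband⟩ := hc
  obtain ⟨i, haLo, haHi, hτ, hlo', hhi'⟩ := hcover a (hW haW).1 (hW haW).2
  exact ⟨i, inBoxWH_of_registeredBH ha.le hA (hreg.reband hlo ha.le hband) haLo haHi hτ hlo' hhi'⟩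

/-! ### §4 the letter-box E-door -/

/-- ★★ **THE LETTER-BOX E-DOOR (door of record for line (D) under (γ-E), PROVED)** — ZZZYREC's `uniformEquilStabilityAtIn_of_atlasW_hollow_window` with:
the cells covering only the E-letter-box `[amin, amax] × [hLoE, hHiE]` (not the clean band), the new leaf (EBAND)(eStar + ν) = (EE) with
`Q = InHBand hLoE hHiE` (certifiable at threshold `eUp + ν`, `EnergyEnclosureP.of_ceiling`), `0 ≤ hLoB`, and the TAME energy-windowed conclusion;
(RI♯-C-W), `HBandP` (clean band), `HollowP`, the per-cell certificates and the budget leaves VERBATIM.  = ZZZYRJ glue ∘ U_Q-from-atlas ∘ band cover.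
Instance of record (ν = 1/2000, census SURV61/EBAND61): TWO cells (0.9718, 1.0, 0 | .035) re-cut to the E-band, margins +0.466 / +0.111. [g104] -/
theorem uniformTameStabilityAtEIn_of_atlasW_hollow_windowE {s Λ c₀ ℓ₀ r₁ ϱ R cZ κ₁ κ₀ γT δ hLoB hHiB ν hLoE hHiE amin amax : ℝ}
    {W : Set ℝ} {aLo aHi τ hLo hHi c cK : ι → ℝ} {ΘR ΘN : ι → (E3 ≃L[ℝ] E3) → (ℤ → E3) → (Cell 2 × ℤ) × (Cell 2 × ℤ) → ℝ}
    (h0 : 0 ≤ κ₁) (hκ : κ₀ ≤ κ₁ * cZ - γT) (hRI : UniformReindexPCIn s Λ c₀ ℓ₀ (IsRegisteredWord δ) W)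
    (hHB : HBandP s Λ c₀ ℓ₀ hLoB hHiB) (hHol : HollowP s Λ c₀ ℓ₀ δ) (hlo : 0 ≤ hLoB) (hcK0 : ∀ i, 0 ≤ cK i) (hcK : ∀ i, cK i * c i ≤ 1)
    (hCS : CellSumP s Λ c₀ ℓ₀ r₁) (hNC : CellNullLagrangianP s Λ c₀ ℓ₀ r₁) (hW : W ⊆ Set.Icc amin amax)
    (hEB : EnergyEnclosureP s Λ c₀ ℓ₀ (eStar + ν) (InHBand hLoE hHiE) W)
    (hcover : ∀ a : ℝ, amin ≤ a → a ≤ amax → ∃ i, aLo i ≤ a ∧ a ≤ aHi i ∧ δ ≤ τ i ∧ hLo i ≤ hLoE ∧ hHiE ≤ hHi i)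
    (hcell : ∀ i, BoxCellCertificateP s Λ c₀ ℓ₀ r₁ (InBoxWH s (aLo i) (aHi i) (τ i) (hLo i) (hHi i)) (c i))
    (htail : ∀ i, BoxTailDebitP s Λ c₀ ℓ₀ ϱ (InBoxWH s (aLo i) (aHi i) (τ i) (hLo i) (hHi i)) (ΘR i) (ΘN i) γT)
    (hPU : PartitionIdentityFullP s Λ c₀ ℓ₀ r₁ ϱ R) (hPD : PartitionIdentityDebitP s Λ c₀ ℓ₀ ϱ R)
    (hclus : ∀ i, BoxClusterCertificateDebitP s Λ c₀ ℓ₀ r₁ ϱ R (InBoxWH s (aLo i) (aHi i) (τ i) (hLo i) (hHi i)) (cK i) (ΘR i) (ΘN i) κ₁)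
    (hCZ : IndexCurrencyP s Λ c₀ ℓ₀ r₁ cZ) : UniformTameStabilityAtEIn s Λ κ₀ c₀ (max Λ ℓ₀) ν W :=
  uniformTameStabilityAtEIn_of_enclosure_of_cells (uniformReindexPCIn_window (uniformReindexPCIn_bandedHollow hRI hHB hHol)) hEB
    (wordStabilityP_of_atlas h0 hκ hcK0 hcK hCS hNC (atlasCoversPC_bandWindow hlo hW hcover) hcell htail hPU hPD hclus hCZ)

/-- the same door at a CERTIFIED threshold: (EBAND)(eUp + ν) with a periodic ceiling `e(P) ≤ eUp` (instance `eUp = −0.7175`, tree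
`FrustratedLawDichotomyPeriodicEnergyCeilingKernel.periodicEnergyCeiling_holds`). [g104] -/
theorem uniformTameStabilityAtEIn_of_atlasW_hollow_windowE_ceiling {s Λ c₀ ℓ₀ r₁ ϱ R cZ κ₁ κ₀ γT δ hLoB hHiB eUp ν hLoE hHiE amin amax : ℝ}
    {W : Set ℝ} {aLo aHi τ hLo hHi c cK : ι → ℝ} {ΘR ΘN : ι → (E3 ≃L[ℝ] E3) → (ℤ → E3) → (Cell 2 × ℤ) × (Cell 2 × ℤ) → ℝ}
    (h0 : 0 ≤ κ₁) (hκ : κ₀ ≤ κ₁ * cZ - γT) (hRI : UniformReindexPCIn s Λ c₀ ℓ₀ (IsRegisteredWord δ) W)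
    (hHB : HBandP s Λ c₀ ℓ₀ hLoB hHiB) (hHol : HollowP s Λ c₀ ℓ₀ δ) (hlo : 0 ≤ hLoB) (hcK0 : ∀ i, 0 ≤ cK i) (hcK : ∀ i, cK i * c i ≤ 1)
    (hCS : CellSumP s Λ c₀ ℓ₀ r₁) (hNC : CellNullLagrangianP s Λ c₀ ℓ₀ r₁) (hW : W ⊆ Set.Icc amin amax)
    (hup : ∃ P : PeriodicConfiguration 3, P.energyPerParticle lennardJones ≤ eUp)
    (hEB : EnergyEnclosureP s Λ c₀ ℓ₀ (eUp + ν) (InHBand hLoE hHiE) W)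
    (hcover : ∀ a : ℝ, amin ≤ a → a ≤ amax → ∃ i, aLo i ≤ a ∧ a ≤ aHi i ∧ δ ≤ τ i ∧ hLo i ≤ hLoE ∧ hHiE ≤ hHi i)
    (hcell : ∀ i, BoxCellCertificateP s Λ c₀ ℓ₀ r₁ (InBoxWH s (aLo i) (aHi i) (τ i) (hLo i) (hHi i)) (c i))
    (htail : ∀ i, BoxTailDebitP s Λ c₀ ℓ₀ ϱ (InBoxWH s (aLo i) (aHi i) (τ i) (hLo i) (hHi i)) (ΘR i) (ΘN i) γT)
    (hPU : PartitionIdentityFullP s Λ c₀ ℓ₀ r₁ ϱ R) (hPD : PartitionIdentityDebitP s Λ c₀ ℓ₀ ϱ R)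
    (hclus : ∀ i, BoxClusterCertificateDebitP s Λ c₀ ℓ₀ r₁ ϱ R (InBoxWH s (aLo i) (aHi i) (τ i) (hLo i) (hHi i)) (cK i) (ΘR i) (ΘN i) κ₁)
    (hCZ : IndexCurrencyP s Λ c₀ ℓ₀ r₁ cZ) : UniformTameStabilityAtEIn s Λ κ₀ c₀ (max Λ ℓ₀) ν W :=
  uniformTameStabilityAtEIn_of_atlasW_hollow_windowE h0 hκ hRI hHB hHol hlo hcK0 hcK hCS hNC hW (EnergyEnclosureP.of_ceiling hup hEB) hcover
    hcell htail hPU hPD hclus hCZ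

/-- CONSISTENCY: with the energy-blind band (`HBandP.enclosure`) and cells over the CLEAN band the letter-box E-door is ZZZYREC's door of record with
the tame E-conclusion — the E-architecture asks LESS of the atlas and one leaf MORE, (EBAND). [g104] -/
example {s Λ c₀ ℓ₀ r₁ ϱ R cZ κ₁ κ₀ γT δ hLoB hHiB ν amin amax : ℝ}
    {W : Set ℝ} {aLo aHi τ hLo hHi c cK : ι → ℝ} {ΘR ΘN : ι → (E3 ≃L[ℝ] E3) → (ℤ → E3) → (Cell 2 × ℤ) × (Cell 2 × ℤ) → ℝ}
    (h0 : 0 ≤ κ₁) (hκ : κ₀ ≤ κ₁ * cZ - γT) (hRI : UniformReindexPCIn s Λ c₀ ℓ₀ (IsRegisteredWord δ) W)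
    (hHB : HBandP s Λ c₀ ℓ₀ hLoB hHiB) (hHol : HollowP s Λ c₀ ℓ₀ δ) (hlo : 0 ≤ hLoB) (hcK0 : ∀ i, 0 ≤ cK i) (hcK : ∀ i, cK i * c i ≤ 1)
    (hCS : CellSumP s Λ c₀ ℓ₀ r₁) (hNC : CellNullLagrangianP s Λ c₀ ℓ₀ r₁) (hW : W ⊆ Set.Icc amin amax)
    (hcover : ∀ a : ℝ, amin ≤ a → a ≤ amax → ∃ i, aLo i ≤ a ∧ a ≤ aHi i ∧ δ ≤ τ i ∧ hLo i ≤ hLoB ∧ hHiB ≤ hHi i)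
    (hcell : ∀ i, BoxCellCertificateP s Λ c₀ ℓ₀ r₁ (InBoxWH s (aLo i) (aHi i) (τ i) (hLo i) (hHi i)) (c i))
    (htail : ∀ i, BoxTailDebitP s Λ c₀ ℓ₀ ϱ (InBoxWH s (aLo i) (aHi i) (τ i) (hLo i) (hHi i)) (ΘR i) (ΘN i) γT)
    (hPU : PartitionIdentityFullP s Λ c₀ ℓ₀ r₁ ϱ R) (hPD : PartitionIdentityDebitP s Λ c₀ ℓ₀ ϱ R)
    (hclus : ∀ i, BoxClusterCertificateDebitP s Λ c₀ ℓ₀ r₁ ϱ R (InBoxWH s (aLo i) (aHi i) (τ i) (hLo i) (hHi i)) (cK i) (ΘR i) (ΘN i) κ₁)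
    (hCZ : IndexCurrencyP s Λ c₀ ℓ₀ r₁ cZ) : UniformTameStabilityAtEIn s Λ κ₀ c₀ (max Λ ℓ₀) ν W :=
  uniformTameStabilityAtEIn_of_atlasW_hollow_windowE h0 hκ hRI hHB hHol hlo hcK0 hcK hCS hNC hW (hHB.enclosure (eStar + ν) W) hcover hcell htail
    hPU hPD hclus hCZ

end Summit.AtomisticToContinuum.Crystallization.Theorems.ChartedZeroExcessLayeredLatticeLiouville

end
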